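import Summits.CriticalPhenomena.PercolationContinuityZ3.Theorems.Transplant.SqShadowSurgOut
import HarnessLib

/-!
# SQUARE SHADOWS — port of «HexShadowFact2Reduction» to the square-shadow interface: Lemma 7 for separated families of located surgeries, the node `SqLocatedSurgeries`, **Fact 2 and the Gluing Lemma from it**

builds on p205010 (kernel theorem, internal audit signed; external expert review pending) — NOT used in this file.  Lane `prim-bschramm`, seat `prim-bschramm-p2` (gen 42; class C1b;
memo §148); helper file (`--supports stmt-CriticalPhenomena-4575 --as helper`).  Statements and proofs verbatim from the squareal twin with `Ψ : SqShadow G` for `Φ : HexShadow G` and sup-norm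
squares `sqBall` for lattice squares.
[cite: DuminilCopinSidoraviciusTassion2016, §2.3 (proof of Fact 2, pp. 6–7; Lemma 7)]
-/

noncomputable section

namespace Summit.CriticalPhenomena.PercolationContinuityZ3.Theorems.Transplant

open MeasureTheory Literature.Probability.Percolation Literature.Probability.LatticeModels SimpleGraph Filter
open scoped Classical Topology

namespace SqShadow

variable {V : Type} {G : SimpleGraph V} (Ψ : SqShadow G) [Countable V]

/-! ## §1 Lemma 7 for located surgeries -/

/-- PROVED — **Lemma 7 applied to a separated family of located surgeries** (the bookkeeping of
the proof of Fact 2, DST 2016, p. 7, in a reusable form): let `E` be an event determined by the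
window `\overline{B_{3n} ∪ B'_n}` such that every lattice configuration `ω ∈ E` carries a set `Zs(ω)` of
at least `t` points, pairwise at sup-distance `> 6`, with a located surgery output of radius `r` at
each. Then `P[E] ≤ (2/min{p,1-p})^{(5k+4)(2r+7)²} / t · P[C]`. The images at two points of `Zs(ω)`
are distinct because their attachment statistics lie over disjoint boxes; every preimage of `ω'`
agrees with `ω'` off the lattice edges touching `\overline{planar(q) + B_{r+3}}`, `q ∈ Att(ω')`.
[cite: DuminilCopinSidoraviciusTassion2016, §2.3, Lemma 7 and proof of Fact 2 (p. 7)] -/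
theorem real_le_of_surgOut (Γ : GlueData) (p : unitInterval) (hp0 : 0 < (p : ℝ)) (hp1 : (p : ℝ) < 1)
    (r : ℕ) {E : Set (BondConfig V)}
    (hE : ∀ ω ω' : BondConfig V,
      (∀ e ∈ (Ψ.lift (Ψ.big Γ ∪ Ψ.small Γ)).sym2, e ∈ ω ↔ e ∈ ω') → (ω ∈ E ↔ ω' ∈ E))
    {t : ℝ} (ht : 0 < t)
    (hfam : ∀ ω : BondConfig V, ω ⊆ G.edgeSet → ω ∈ E →
      ∃ Zs : Finset (Site 2), t ≤ Zs.card ∧ (∀ z ∈ Zs, ∀ z' ∈ Zs, z ≠ z' → z' ∉ sqBall z 6) ∧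
        ∀ z ∈ Zs, ∃ ω', Ψ.SurgOut Γ r ω z ω') :
    (bondPercolation G p).real E ≤
      (2 / min (p : ℝ) (1 - p)) ^ (Ψ.liftBound ^ 2 * (2 * (r + 3) + 1) ^ 2) / t *
        (bondPercolation G p).real (Ψ.evC Γ) := by
  classical
  -- the window
  have hRfin : (Ψ.lift (Ψ.big Γ ∪ Ψ.small Γ)).Finite :=
    Ψ.lift_window_finite Γ
  set K' : Finset (Sym2 V) := (finite_sym2 hRfin).toFinset with hK'def
  have hK'coe : (↑K' : Set (Sym2 V)) = (Ψ.lift (Ψ.big Γ ∪ Ψ.small Γ)).sym2 :=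
    Set.Finite.coe_toFinset _
  set Kfin : Finset (Sym2 V) := K'.filter (· ∈ G.edgeSet) with hKfin
  have hK : ∀ e, e ∈ Kfin ↔ e ∈ K' ∧ e ∈ G.edgeSet := fun e => Finset.mem_filter
  have hKE : ∀ e ∈ Kfin, e ∈ G.edgeSet := fun e he => ((hK e).1 he).2
  have hagree : ∀ ω ω' : BondConfig V, ω ∩ ↑K' = ω' ∩ ↑K' →
      ∀ e ∈ (Ψ.lift (Ψ.big Γ ∪ Ψ.small Γ)).sym2, e ∈ ω ↔ e ∈ ω' := by
    intro ω ω' heq e he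
    rw [← hK'coe] at he
    have := Set.ext_iff.1 heq e
    simp only [Set.mem_inter_iff, he, and_true] at this
    exact this
  have hA : DeterminedBy E ↑K' := by
    rw [determinedBy_iff]
    intro ω ω' heq
    exact hE ω ω' (hagree ω ω' heq)
  have hB : DeterminedBy (Ψ.evC Γ) ↑K' := by
    rw [determinedBy_iff]
    intro ω ω' heq
    exact Ψ.mem_conn_congr Γ (hagree ω ω' heq) (B := Ψ.big Γ ∪ Ψ.small Γ) subset_rfl _ _
  have hlat : ∀ S : Finset (Sym2 V), S ⊆ Kfin →
      (↑S : Set (Sym2 V)) ⊆ G.edgeSet := fun S hS e he => hKE e (hS he)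
  -- surgery outputs lie in the window
  have hnewK : ∀ S : Finset (Sym2 V), S ⊆ Kfin → ∀ (z : Site 2) (ω' : BondConfig V),
      Ψ.SurgOut Γ r (↑S) z ω' → ω' ⊆ ↑Kfin := by
    intro S hS z ω' hso e he
    rcases hso.subset_window he with h | ⟨h1, h2⟩
    · exact hS h
    · rw [Finset.mem_coe, hK]
      exact ⟨by rw [← Finset.mem_coe, hK'coe]; exact h2, h1⟩
  have hcoe : ∀ S : Finset (Sym2 V), S ⊆ Kfin → ∀ (z : Site 2) (ω' : BondConfig V),
      Ψ.SurgOut Γ r (↑S) z ω' → (↑(Kfin.filter (· ∈ ω')) : Set (Sym2 V)) = ω' := by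
    intro S hS z ω' hso
    ext e
    simp only [Finset.coe_filter, Set.mem_setOf_eq, and_iff_right_iff_imp]
    exact fun he => hnewK S hS z ω' hso he
  -- the families, as functions of the configuration
  have hfam' : ∀ S : Finset (Sym2 V),
      (↑S : Set (Sym2 V)) ⊆ G.edgeSet ∧ (↑S : BondConfig V) ∈ E →
      ∃ Zs : Finset (Site 2), t ≤ Zs.card ∧ (∀ z ∈ Zs, ∀ z' ∈ Zs, z ≠ z' → z' ∉ sqBall z 6) ∧
        ∀ z ∈ Zs, ∃ ω', Ψ.SurgOut Γ r (↑S) z ω' := fun S h => hfam _ h.1 h.2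
  let Zs : Finset (Sym2 V) → Finset (Site 2) := fun S =>
    if h : (↑S : Set (Sym2 V)) ⊆ G.edgeSet ∧ (↑S : BondConfig V) ∈ E then
      Classical.choose (hfam' S h) else ∅
  have hZs : ∀ (S : Finset (Sym2 V))
      (h : (↑S : Set (Sym2 V)) ⊆ G.edgeSet ∧ (↑S : BondConfig V) ∈ E),
      t ≤ (Zs S).card ∧ (∀ z ∈ Zs S, ∀ z' ∈ Zs S, z ≠ z' → z' ∉ sqBall z 6) ∧
        ∀ z ∈ Zs S, ∃ ω', Ψ.SurgOut Γ r (↑S) z ω' := by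
    intro S h
    simp only [Zs, dif_pos h]
    exact Classical.choose_spec (hfam' S h)
  let out : Finset (Sym2 V) → (Site 2) → BondConfig V := fun S z =>
    if h : ∃ ω', Ψ.SurgOut Γ r (↑S) z ω' then Classical.choose h else ∅
  have hout : ∀ (S : Finset (Sym2 V)) (z : Site 2), (∃ ω', Ψ.SurgOut Γ r (↑S) z ω') →
      Ψ.SurgOut Γ r (↑S) z (out S z) := by
    intro S z h
    simp only [out, dif_pos h]
    exact Classical.choose_spec h
  -- the multi-valued map
  let Θ : Finset (Sym2 V) → Finset (Finset (Sym2 V)) := fun S =>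
    (Zs S).image fun z => Kfin.filter (· ∈ out S z)
  set s : ℕ := Ψ.liftBound ^ 2 * (2 * (r + 3) + 1) ^ 2 with hs
  refine lemma7_bond G p hp0 hp1 K' Kfin hK hA hB s ht Θ ?_ ?_ ?_
  · -- images lie in `C`
    intro S hS hSA S' hS'
    have h : (↑S : Set (Sym2 V)) ⊆ G.edgeSet ∧ (↑S : BondConfig V) ∈ E :=
      ⟨hlat S hS, hSA⟩
    simp only [Θ, Finset.mem_image] at hS'
    obtain ⟨z, hz, rfl⟩ := hS'
    have hso := hout S z ((hZs S h).2.2 z hz)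
    refine ⟨Finset.filter_subset _ _, ?_⟩
    rw [hcoe S hS z _ hso]
    exact hso.mem_evC
  · -- at least `t` distinct images
    intro S hS hSA
    have h : (↑S : Set (Sym2 V)) ⊆ G.edgeSet ∧ (↑S : BondConfig V) ∈ E :=
      ⟨hlat S hS, hSA⟩
    obtain ⟨hcard, hsep, hex⟩ := hZs S h
    have hinj : Set.InjOn (fun z => Kfin.filter (· ∈ out S z)) ↑(Zs S) := by
      intro z hz z' hz' heq
      by_contra hne
      have hso := hout S z (hex z hz)
      have hso' := hout S z' (hex z' hz')
      have heq' : out S z = out S z' := by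
        have := congrArg (fun F : Finset (Sym2 V) => (↑F : Set (Sym2 V))) heq
        simp only at this
        rwa [hcoe S hS z _ hso, hcoe S hS z' _ hso'] at this
      obtain ⟨q, hq⟩ := hso.att_nonempty
      have h1 := hso.att_near q hq
      rw [heq'] at hq
      have h2 := hso'.att_near q hq
      exact hsep z hz z' hz' hne (mem_sqBall_six_of_three h1 h2)
    simp only [Θ]
    rw [Finset.card_image_of_injOn hinj]
    exact hcard
  · -- the recovery window
    intro S' hS' _
    by_cases hq : (Ψ.att Γ (↑S' : BondConfig V)).Nonempty
    · obtain ⟨q₀, hq₀⟩ := hq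
      refine ⟨Kfin.filter fun e => ∃ u ∈ e, Ψ.sh u ∈ (sqBall_finite (Ψ.sh q₀) (r + 3)).toFinset,
        ?_, ?_⟩
      · refine (Ψ.card_filter_cols_le Kfin hKE _).trans ?_
        have := card_toFinset_sqBall_le (Ψ.sh q₀) (r + 3)
        rw [hs]; exact Nat.mul_le_mul_left _ this
      · intro S hS hSA hmem e heT
        have h : (↑S : Set (Sym2 V)) ⊆ G.edgeSet ∧ (↑S : BondConfig V) ∈ E :=
          ⟨hlat S hS, hSA⟩
        simp only [Θ, Finset.mem_image] at hmem
        obtain ⟨z, hz, rfl⟩ := hmem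
        have hso := hout S z ((hZs S h).2.2 z hz)
        have hcoe' := hcoe S hS z _ hso
        rw [hcoe'] at hq₀
        have hq₀z : Ψ.sh q₀ ∈ sqBall z 3 := hso.att_near q₀ hq₀
        have hsub : sqBall z r ⊆ sqBall (Ψ.sh q₀) (r + 3) := sqBall_subset_sqBall_add_three hq₀z r
        by_cases heK : e ∈ Kfin
        · have hnt : e ∉ Ψ.touch (sqBall z r) := by
            rintro ⟨x, hx, hxD⟩
            exact heT (Finset.mem_filter.2 ⟨heK, x, hx, (Set.Finite.mem_toFinset _).2 (hsub hxD)⟩)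
          have := hso.agree_off e hnt
          rw [Finset.mem_filter]
          constructor
          · intro heS; exact ⟨heK, this.2 heS⟩
          · intro heS'; exact this.1 heS'.2
        · constructor
          · intro heS; exact absurd (hS heS) heK
          · intro heS'; exact absurd (Finset.mem_filter.1 heS').1 heK
    · refine ⟨∅, by simp, ?_⟩
      intro S hS hSA hmem
      exfalso
      apply hq
      have h : (↑S : Set (Sym2 V)) ⊆ G.edgeSet ∧ (↑S : BondConfig V) ∈ E :=
        ⟨hlat S hS, hSA⟩
      simp only [Θ, Finset.mem_image] at hmem
      obtain ⟨z, hz, rfl⟩ := hmem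
      have hso := hout S z ((hZs S h).2.2 z hz)
      rw [hcoe S hS z _ hso]
      exact hso.att_nonempty

/-- PROVED — **located surgeries at all but `N₀` points of `U` bound `P[𝒳 ∩ {|U| ≥ t}]` for
`t ≥ 2N₀`**: `P[𝒳 ∩ {|U| ≥ t}] ≤ 338 (2/min{p,1-p})^{(5k+4)(2r+7)²} / t · P[C]` (a `7`-separated
subfamily of the given points has at least `(t - N₀)/169 ≥ t/338` members,
`exists_separated_subset`; Lemma 7). [cite: DuminilCopinSidoraviciusTassion2016, §2.3, proof of Fact 2 (p. 7)] -/
theorem real_evX_ncard_le (Γ : GlueData) (p : unitInterval) (hp0 : 0 < (p : ℝ)) (hp1 : (p : ℝ) < 1) (r N₀ : ℕ)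
    (h1 : ∀ ω : BondConfig V, ω ⊆ G.edgeSet → ω ∈ Ψ.evX Γ →
      ∃ Good : Finset (Site 2), (↑Good : Set (Site 2)) ⊆ Ψ.U Γ ω ∧ (Ψ.U Γ ω).ncard ≤ Good.card + N₀ ∧
        ∀ z ∈ Good, ∃ ω' : BondConfig V, Ψ.SurgOut Γ r ω z ω')
    {t : ℕ} (ht : 1 ≤ t) (htN : 2 * N₀ ≤ t) :
    (bondPercolation G p).real (Ψ.evX Γ ∩ {ω | t ≤ (Ψ.U Γ ω).ncard}) ≤
      338 * (2 / min (p : ℝ) (1 - p)) ^ (Ψ.liftBound ^ 2 * (2 * (r + 3) + 1) ^ 2) / t *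
        (bondPercolation G p).real (Ψ.evC Γ) := by
  have ht0 : (0 : ℝ) < (t : ℝ) / 338 := by positivity
  have := Ψ.real_le_of_surgOut Γ p hp0 hp1 r (E := Ψ.evX Γ ∩ {ω | t ≤ (Ψ.U Γ ω).ncard}) ?_ ht0 ?_
  · refine this.trans_eq ?_
    congr 1
    field_simp
  · intro ω ω' h
    simp only [Set.mem_inter_iff, Set.mem_setOf_eq]
    rw [Ψ.mem_evX_congr Γ h, Ψ.U_congr Γ h]
  · rintro ω hω ⟨hX, htU⟩
    obtain ⟨Good, -, hcardU, hsurg⟩ := h1 ω hω hX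
    obtain ⟨Sel, hSel, hsep, hcard⟩ := exists_separated_subset_sq 6 Good
    refine ⟨Sel, ?_, hsep, fun z hz => hsurg z (hSel hz)⟩
    have hc' : ((Good.card : ℕ) : ℝ) ≤ 169 * Sel.card := by
      have : Good.card ≤ 169 * Sel.card := by simpa using hcard
      exact_mod_cast this
    have hU' : ((Ψ.U Γ ω).ncard : ℝ) ≤ Good.card + N₀ := by exact_mod_cast hcardU
    have htU' : (t : ℝ) ≤ (Ψ.U Γ ω).ncard := by exact_mod_cast htU
    have htN' : (2 * N₀ : ℝ) ≤ t := by exact_mod_cast htN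
    rw [div_le_iff₀ (by norm_num : (0 : ℝ) < 338)]
    linarith

/-! ## §2 The node and Fact 2 from it -/

/-- **NODE — located surgeries at almost every point of `U(ω)`** (DST §2.3, proof of Fact 2: the routing "three disjoint self-avoiding paths in
`\overline{B_R}(z) ∖ {z}` connecting `u` to `u'`, `v` to `v'`, `w` to `w'`", pp. 6–7): for `0 < p < 1`... (no `p` in fact) there are a radius `r`, an exceptional
count `N₀` and a scale `m₀` such that for all data in range with `m ≥ m₀` and every lattice configuration `ω ∈ 𝒳`, located surgery outputs of radius `r` exist
at all but at most `N₀` points of `U(ω)`.  Internal obligation, never asserted; to be supplied by the instance (the `(111)`-films `F_k`, `k ≥ 3`; `𝕋 × {0..k}`).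
[cite: DuminilCopinSidoraviciusTassion2016, §2.3 (proof of Fact 2, pp. 6–7)] [cite: NewmanTassionWu2017, §3.2 (Def. 3.7, proof of Thm. 3.9)] -/
def SqLocatedSurgeries {V : Type} {G : SimpleGraph V} (Ψ : SqShadow G) [Countable V] : Prop :=
  ∃ r N₀ m₀ : ℕ, ∀ Γ : GlueData, m₀ ≤ Γ.m → Ψ.InRange Γ → ∀ ω : BondConfig V, ω ⊆ G.edgeSet → ω ∈ Ψ.evX Γ →
    ∃ Good : Finset (Site 2), (↑Good : Set (Site 2)) ⊆ Ψ.U Γ ω ∧ (Ψ.U Γ ω).ncard ≤ Good.card + N₀ ∧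
      ∀ z ∈ Good, ∃ ω' : BondConfig V, Ψ.SurgOut Γ r ω z ω'

/-- **FACT 2 FROM THE NODE** ("Choosing `t` large enough concludes the proof", p. 7): `t ≥ max(2N₀, 338 λ^s / ε)`.
[cite: DuminilCopinSidoraviciusTassion2016, §2.3 (Fact 2 and its proof, pp. 6–7)] -/
theorem sqFact2_of_locatedSurgeries (h : Ψ.SqLocatedSurgeries) : Ψ.SqFact2 := by
  intro p hp0 hp1 ε hε
  obtain ⟨r, N₀, m₀, hsurg⟩ := h
  set lam : ℝ := 2 / min (p : ℝ) (1 - p) with hlam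
  set s : ℕ := Ψ.liftBound ^ 2 * (2 * (r + 3) + 1) ^ 2 with hs
  set K : ℝ := 338 * lam ^ s with hK
  have hK0 : 0 ≤ K := by
    have : 0 ≤ lam := by rw [hlam]; exact div_nonneg (by norm_num) (le_min hp0.le (by linarith))
    positivity
  obtain ⟨t₀, ht₀⟩ := exists_nat_gt (max (2 * N₀ : ℝ) (K / ε))
  refine ⟨t₀, m₀, fun Γ hm hΓ => ?_⟩
  have ht₀N : 2 * N₀ ≤ t₀ := by exact_mod_cast ((le_max_left _ _).trans_lt ht₀).le
  have ht₀1 : 1 ≤ t₀ := by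
    have : (0 : ℝ) < t₀ := lt_of_le_of_lt (by positivity) ht₀
    exact_mod_cast Nat.one_le_iff_ne_zero.2 (by rintro rfl; simp at this)
  have hbound := Ψ.real_evX_ncard_le Γ p hp0 hp1 r N₀ (fun ω hω hX => hsurg Γ hm hΓ ω hω hX) ht₀1 ht₀N
  rw [← hlam, ← hs] at hbound
  refine hbound.trans (mul_le_mul_of_nonneg_right ?_ measureReal_nonneg)
  have ht0 : (0 : ℝ) < t₀ := by exact_mod_cast ht₀1
  rw [div_le_iff₀ ht0]
  have := (le_max_right (2 * N₀ : ℝ) (K / ε)).trans_lt ht₀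
  rw [div_lt_iff₀ hε] at this
  rw [← hK]; linarith

/-- **THE GLUING LEMMA FROM THE NODE** (Fact 1 is proved, «HexShadowFact1»). [cite: DuminilCopinSidoraviciusTassion2016, Lemma 6 and §2.3] -/
theorem sqGluing_of_locatedSurgeries (h : Ψ.SqLocatedSurgeries) : Ψ.SqGluing := Ψ.sqGluing_of_fact2 (Ψ.sqFact2_of_locatedSurgeries h)

end SqShadow

end Summit.CriticalPhenomena.PercolationContinuityZ3.Theorems.Transplant

end
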